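import Summits.BirchSwinnertonDyer.Rank1Residual.GaloisImage.TameThreeTorsionValuation
import Mathlib.Algebra.Polynomial.Splits
import Mathlib.FieldTheory.IsAlgClosed.Basic
import HarnessLib

/-!
# Valuations of the `3`-torsion abscissae on a `III`-shaped equation over `ℚ̄` (valuation form)
# (cell `b2b-bsdres`, team n1011, seat p14 gen 2, OWNERS row T-b9 'tame tower at 3', step S1, field form)

HONEST FRAMING (cell `b2b-bsdres`, run/shared/lean/b2b/bsd-rank1-residual/, verbatim in every
file): the goal of the cell is to DELETE the COMBINATION-SHAPED residual classes of the
Birch–Swinnerton-Dyer formula for ALL analytic-rank `≤ 1` elliptic curves over `ℚ` — "full BSD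
formula for every rank `≤ 1` curve in class `C`" assembled STRICTLY from published theorems — so
that the rank-`≤ 1` remainder becomes exactly the CONSTRUCTION-SHAPED classes, which are TYPED
(missing-input `Prop`s), NOT attempted. This is not "finishing BSD". Team n1011 (N10 / N11, the
additive block X4 ∧ `p = 3`): research route on the CONSTRUCTION-SHAPED class X4; no claim beyond the
stated classes; nothing is booked. Theorems only (no definition, no named fact).

## What this file proves

The statements of `GaloisImage/TameThreeTorsionValuation.lean` and `…CaseA.lean` (integral models,
hypotheses `3 ∣ b₂`, `3 ∥ b₄`, `9 ∣ b₆`) for an ARBITRARY Weierstrass equation `W` over `ℚ̄` whose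
coefficients satisfy the `III`-shape IN VALUATION FORM at the place `v` over `3`:
`v(b₂) ≤ v(3)`, `v(b₄) = v(3)`, `v(b₆) ≤ v(3)²`, `v(b₈) = v(3)²` (CASE B: `v(b₂) ≤ v(3)²`;
CASE A: `v(b₂) = v(3)`).  This is the form in which the `III*` case reduces to the `III` case (the
`ℚ̄`-isomorphism `⟨√3, 0, 0, 0⟩ • W` divides `bᵢ` by `3^(i/2)`), and the form consumed by step S2
(`TameNineTorsionValuation`).  Roots `ξ ∈ ℚ̄` of `ψ₃ = 3X⁴ + b₂X³ + 3b₄X² + 3b₆X + b₈`: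

* `valuation_le_one_of_isRoot_Ψ₃'` — `v(ξ) ≤ 1`;
* `valuation_pow_four_eq_of_isRoot_Ψ₃'` — CASE B: `v(ξ)⁴ = v(3)`;
* `valuation_eq_one_or_pow_three_eq_of_isRoot_Ψ₃'` — CASE A: `v(ξ) = 1 ∨ v(ξ)³ = v(3)`;
* `exists_isRoot_Ψ₃_valuation_pow_three_eq'` — CASE A: some root has `v(ξ)³ = v(3)`.

Proofs: the dominant-term arguments of the integral files, verbatim on the valuation hypotheses.
Step S1 only; no tower claimed.  References: Tate 1975 / Silverman *ATAEC* IV.9.4; *AEC* Ex. 3.7.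
-/

noncomputable section

open scoped Classical

open Polynomial WeierstrassCurve

namespace Summit.BirchSwinnertonDyer.Rank1Residual.GaloisImage

open Literature.NumberTheory.EllipticCurves

variable (W : WeierstrassCurve (AlgebraicClosure ℚ))

/-- `ψ₃` of an equation over `ℚ̄`, evaluated. [folklore] -/
theorem eval_Ψ₃ (x : AlgebraicClosure ℚ) :
    W.Ψ₃.eval x = 3 * x ^ 4 + W.b₂ * x ^ 3 + 3 * W.b₄ * x ^ 2 + 3 * W.b₆ * x + W.b₈ := by
  simp [WeierstrassCurve.Ψ₃]

/-- The root equation of `ψ₃` over `ℚ̄`. [folklore] -/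
theorem eq_zero_of_isRoot_Ψ₃' (x : AlgebraicClosure ℚ) (hx : W.Ψ₃.IsRoot x) :
    3 * x ^ 4 + W.b₂ * x ^ 3 + 3 * W.b₄ * x ^ 2 + 3 * W.b₆ * x + W.b₈ = 0 := by
  have := hx; rwa [IsRoot.def, eval_Ψ₃] at this

/-- **Every root of `ψ₃` is integral at `3`** on a `III`-shaped equation over `ℚ̄` in valuation form
(`v(b₂), v(b₄) ≤ v(3)`, `v(b₆), v(b₈) ≤ v(3)²`): for `v(ξ) > 1` the term `3ξ⁴` strictly dominates. [folklore] -/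
theorem valuation_le_one_of_isRoot_Ψ₃' (hb2v : (placeOver 3).valuation W.b₂ ≤ (placeOver 3).valuation (3 : AlgebraicClosure ℚ))
    (hb4v : (placeOver 3).valuation W.b₄ ≤ (placeOver 3).valuation (3 : AlgebraicClosure ℚ))
    (hb6v : (placeOver 3).valuation W.b₆ ≤ (placeOver 3).valuation (3 : AlgebraicClosure ℚ) ^ 2)
    (hb8v : (placeOver 3).valuation W.b₈ ≤ (placeOver 3).valuation (3 : AlgebraicClosure ℚ) ^ 2)
    {x : AlgebraicClosure ℚ}
    (hx : W.Ψ₃.IsRoot x) :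
    (placeOver 3).valuation x ≤ 1 := by
  set v := (placeOver 3).valuation with hv
  set t := v (3 : AlgebraicClosure ℚ) with ht
  have ht1 : t < 1 := valuation_three_lt_one
  have ht0 : t ≠ 0 := valuation_three_ne_zero
  have heval := eq_zero_of_isRoot_Ψ₃' W x hx
  by_contra hle
  rw [not_le] at hle
  set u := v x with hu
  have hu0 : u ≠ 0 := by rintro h0; rw [h0] at hle; exact not_lt_zero hle
  -- the four strict dominations by `v(3x⁴) = t u⁴`
  have hd : v (3 * x ^ 4) = t * u ^ 4 := by rw [map_mul, map_pow]
  have h1 : v (W.b₂ * x ^ 3) < t * u ^ 4 := by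
    rw [map_mul, map_pow]
    calc v W.b₂ * u ^ 3 ≤ t * u ^ 3 := by gcongr
      _ < t * u ^ 4 := mul_lt_mul_left_of_ne_zero ht0 (pow_lt_pow_right₀ hle (by norm_num))
  have h2 : v (3 * W.b₄ * x ^ 2) < t * u ^ 4 := by
    rw [map_mul, map_mul, map_pow]
    have hu2 : 1 < u ^ 2 := one_lt_pow₀ hle (by norm_num)
    have hu20 : u ^ 2 ≠ 0 := pow_ne_zero 2 hu0
    have key : t * u ^ 2 < u ^ 2 * u ^ 2 :=
      calc t * u ^ 2 < 1 * u ^ 2 := mul_lt_mul_right_of_ne_zero' hu20 ht1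
        _ = u ^ 2 * 1 := by rw [one_mul, mul_one]
        _ < u ^ 2 * u ^ 2 := mul_lt_mul_left_of_ne_zero hu20 hu2
    calc t * v W.b₄ * u ^ 2 ≤ t * t * u ^ 2 := by gcongr
      _ = t * (t * u ^ 2) := mul_assoc _ _ _
      _ < t * (u ^ 2 * u ^ 2) := mul_lt_mul_left_of_ne_zero ht0 key
      _ = t * u ^ 4 := by rw [← pow_add]
  have h3 : v (3 * W.b₆ * x) < t * u ^ 4 := by
    rw [map_mul, map_mul]
    have ht2 : t ^ 2 < 1 := pow_lt_one₀ zero_le ht1 (by norm_num)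
    have hu3 : 1 < u ^ 3 := one_lt_pow₀ hle (by norm_num)
    have key : t ^ 2 * u < u ^ 3 * u := mul_lt_mul_right_of_ne_zero' hu0 (ht2.trans hu3)
    calc t * v W.b₆ * u ≤ t * t ^ 2 * u := by gcongr
      _ = t * (t ^ 2 * u) := mul_assoc _ _ _
      _ < t * (u ^ 3 * u) := mul_lt_mul_left_of_ne_zero ht0 key
      _ = t * u ^ 4 := by rw [← pow_succ]
  have h4 : v W.b₈ < t * u ^ 4 := by
    have hu4 : 1 < u ^ 4 := one_lt_pow₀ hle (by norm_num)
    calc v W.b₈ ≤ t ^ 2 := hb8v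
      _ = t * t := sq t
      _ < t * 1 := mul_lt_mul_left_of_ne_zero ht0 ht1
      _ < t * u ^ 4 := mul_lt_mul_left_of_ne_zero ht0 hu4
  have hr : v (W.b₂ * x ^ 3 + 3 * W.b₄ * x ^ 2 +
      3 * W.b₆ * x + W.b₈) < v (3 * x ^ 4) := by
    rw [hd]
    exact Valuation.map_add_lt _ (Valuation.map_add_lt _ (Valuation.map_add_lt _ h1 h2) h3) h4
  refine false_of_dominant v ?_ hr
  rw [← heval]; ring

/-- **CASE B (`v(b₂) ≤ v(3)²`): every root of `ψ₃` has `v(ξ)⁴ = v(3)`** on a `III`-shaped equation over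
`ℚ̄` in valuation form — single Newton segment of slope `-1/4`. [folklore] -/
theorem valuation_pow_four_eq_of_isRoot_Ψ₃' (hb2v : (placeOver 3).valuation W.b₂ ≤ (placeOver 3).valuation (3 : AlgebraicClosure ℚ) ^ 2)
    (hb4v : (placeOver 3).valuation W.b₄ = (placeOver 3).valuation (3 : AlgebraicClosure ℚ))
    (hb6v : (placeOver 3).valuation W.b₆ ≤ (placeOver 3).valuation (3 : AlgebraicClosure ℚ) ^ 2)
    (hb8v : (placeOver 3).valuation W.b₈ = (placeOver 3).valuation (3 : AlgebraicClosure ℚ) ^ 2)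
    {x : AlgebraicClosure ℚ}
    (hx : W.Ψ₃.IsRoot x) :
    (placeOver 3).valuation x ^ 4 = (placeOver 3).valuation (3 : AlgebraicClosure ℚ) := by
  set v := (placeOver 3).valuation with hv
  set t := v (3 : AlgebraicClosure ℚ) with ht
  have ht1 : t < 1 := valuation_three_lt_one
  have ht0 : t ≠ 0 := valuation_three_ne_zero
  have heval := eq_zero_of_isRoot_Ψ₃' W x hx
  set u := v x with hu
  have httle : t ^ 2 ≤ t := by
    calc t ^ 2 = t * t := sq t
      _ ≤ t * 1 := mul_le_mul' le_rfl ht1.le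
      _ = t := mul_one _
  have hule : u ≤ 1 :=
    valuation_le_one_of_isRoot_Ψ₃' W (hb2v.trans httle) hb4v.le hb6v hb8v.le hx
  rcases lt_trichotomy (u ^ 4) t with hlt | heq | hgt
  · -- `b₈` dominates
    exfalso
    have hu1 : u < 1 := by
      rcases hule.lt_or_eq with h | h
      · exact h
      · exfalso; rw [h, one_pow] at hlt; exact absurd (ht1.trans hlt) (lt_irrefl _)
    have h1 : v (3 * x ^ 4) < t ^ 2 := by
      rw [map_mul, map_pow, sq]; exact mul_lt_mul_left_of_ne_zero ht0 hlt
    have h2 : v (W.b₂ * x ^ 3) < t ^ 2 := by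
      rw [map_mul, map_pow]
      calc v W.b₂ * u ^ 3 ≤ t ^ 2 * u ^ 3 := by gcongr
        _ < t ^ 2 * 1 := mul_lt_mul_left_of_ne_zero (pow_ne_zero 2 ht0) (pow_lt_one₀ zero_le hu1 (by norm_num))
        _ = t ^ 2 := mul_one _
    have h3 : v (3 * W.b₄ * x ^ 2) < t ^ 2 := by
      rw [map_mul, map_mul, map_pow, hb4v, ← sq]
      calc t ^ 2 * u ^ 2 < t ^ 2 * 1 :=
            mul_lt_mul_left_of_ne_zero (pow_ne_zero 2 ht0) (pow_lt_one₀ zero_le hu1 (by norm_num))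
        _ = t ^ 2 := mul_one _
    have h4 : v (3 * W.b₆ * x) < t ^ 2 := by
      rw [map_mul, map_mul]
      calc t * v W.b₆ * u ≤ t * t ^ 2 * 1 := by gcongr
        _ = t ^ 2 * t := by rw [mul_one, mul_comm]
        _ < t ^ 2 * 1 := mul_lt_mul_left_of_ne_zero (pow_ne_zero 2 ht0) ht1
        _ = t ^ 2 := mul_one _
    have hr : v (3 * x ^ 4 + W.b₂ * x ^ 3 +
        3 * W.b₄ * x ^ 2 + 3 * W.b₆ * x) <
        v W.b₈ := by
      rw [hb8v]
      exact Valuation.map_add_lt _ (Valuation.map_add_lt _ (Valuation.map_add_lt _ h1 h2) h3) h4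
    refine false_of_dominant v ?_ hr
    rw [← heval]; ring
  · exact heq
  · -- `3x⁴` dominates
    exfalso
    have hu0 : u ≠ 0 := by rintro h0; rw [h0, zero_pow (by norm_num)] at hgt; exact not_lt_zero hgt
    have htu : t < u := hgt.trans_le (by simpa using pow_le_pow_of_le_one' hule (show 1 ≤ 4 by norm_num))
    have hd : v (3 * x ^ 4) = t * u ^ 4 := by rw [map_mul, map_pow]
    have h1 : v (W.b₂ * x ^ 3) < t * u ^ 4 := by
      rw [map_mul, map_pow]
      have key : t * u ^ 3 < u * u ^ 3 := mul_lt_mul_right_of_ne_zero' (pow_ne_zero 3 hu0) htu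
      calc v W.b₂ * u ^ 3 ≤ t ^ 2 * u ^ 3 := by gcongr
        _ = t * (t * u ^ 3) := by rw [sq, mul_assoc]
        _ < t * (u * u ^ 3) := mul_lt_mul_left_of_ne_zero ht0 key
        _ = t * u ^ 4 := by rw [← pow_succ']
    have h2 : v (3 * W.b₄ * x ^ 2) < t * u ^ 4 := by
      rw [map_mul, map_mul, map_pow, hb4v]
      have htu2 : t < u ^ 2 := hgt.trans_le (pow_le_pow_of_le_one' hule (show 2 ≤ 4 by norm_num))
      have key : t * u ^ 2 < u ^ 2 * u ^ 2 := mul_lt_mul_right_of_ne_zero' (pow_ne_zero 2 hu0) htu2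
      calc t * t * u ^ 2 = t * (t * u ^ 2) := mul_assoc _ _ _
        _ < t * (u ^ 2 * u ^ 2) := mul_lt_mul_left_of_ne_zero ht0 key
        _ = t * u ^ 4 := by rw [← pow_add]
    have h3 : v (3 * W.b₆ * x) < t * u ^ 4 := by
      rw [map_mul, map_mul]
      have htt : t ^ 2 < t := by
        calc t ^ 2 = t * t := sq t
          _ < t * 1 := mul_lt_mul_left_of_ne_zero ht0 ht1
          _ = t := mul_one _
      have htu3 : t ^ 2 < u ^ 3 :=
        htt.trans (hgt.trans_le (pow_le_pow_of_le_one' hule (show 3 ≤ 4 by norm_num)))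
      have key : t ^ 2 * u < u ^ 3 * u := mul_lt_mul_right_of_ne_zero' hu0 htu3
      calc t * v W.b₆ * u ≤ t * t ^ 2 * u := by gcongr
        _ = t * (t ^ 2 * u) := mul_assoc _ _ _
        _ < t * (u ^ 3 * u) := mul_lt_mul_left_of_ne_zero ht0 key
        _ = t * u ^ 4 := by rw [← pow_succ]
    have h4 : v W.b₈ < t * u ^ 4 := by
      rw [hb8v, sq]; exact mul_lt_mul_left_of_ne_zero ht0 hgt
    have hr : v (W.b₂ * x ^ 3 + 3 * W.b₄ * x ^ 2 +
        3 * W.b₆ * x + W.b₈) < v (3 * x ^ 4) := by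
      rw [hd]
      exact Valuation.map_add_lt _ (Valuation.map_add_lt _ (Valuation.map_add_lt _ h1 h2) h3) h4
    refine false_of_dominant v ?_ hr
    rw [← heval]; ring


/-- **CASE A (`v(b₂) = v(3)`): every root of `ψ₃` has `v(ξ) = 1` or `v(ξ)³ = v(3)`** on a `III`-shaped
equation over `ℚ̄` in valuation form — Newton slopes `0` and `-1/3`. [folklore] -/
theorem valuation_eq_one_or_pow_three_eq_of_isRoot_Ψ₃' (hb2v : (placeOver 3).valuation W.b₂ = (placeOver 3).valuation (3 : AlgebraicClosure ℚ))
    (hb4v : (placeOver 3).valuation W.b₄ = (placeOver 3).valuation (3 : AlgebraicClosure ℚ))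
    (hb6v : (placeOver 3).valuation W.b₆ ≤ (placeOver 3).valuation (3 : AlgebraicClosure ℚ) ^ 2)
    (hb8v : (placeOver 3).valuation W.b₈ = (placeOver 3).valuation (3 : AlgebraicClosure ℚ) ^ 2)
    {x : AlgebraicClosure ℚ}
    (hx : W.Ψ₃.IsRoot x) :
    (placeOver 3).valuation x = 1 ∨
      (placeOver 3).valuation x ^ 3 = (placeOver 3).valuation (3 : AlgebraicClosure ℚ) := by
  set v := (placeOver 3).valuation with hv
  set t := v (3 : AlgebraicClosure ℚ) with ht
  have ht1 : t < 1 := valuation_three_lt_one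
  have ht0 : t ≠ 0 := valuation_three_ne_zero
  have heval := eq_zero_of_isRoot_Ψ₃' W x hx
  set u := v x with hu
  have hule : u ≤ 1 := valuation_le_one_of_isRoot_Ψ₃' W hb2v.le hb4v.le hb6v hb8v.le hx
  by_cases hu1 : u = 1
  · exact Or.inl hu1
  right
  have hult : u < 1 := lt_of_le_of_ne hule hu1
  have htt : t ^ 2 < t := by
    calc t ^ 2 = t * t := sq t
      _ < t * 1 := mul_lt_mul_left_of_ne_zero ht0 ht1
      _ = t := mul_one _
  rcases lt_trichotomy (u ^ 3) t with hlt | heq | hgt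
  · -- `b₈` dominates
    exfalso
    have h1 : v (3 * x ^ 4) < t ^ 2 := by
      rw [map_mul, map_pow, sq]
      calc t * u ^ 4 ≤ t * u ^ 3 :=
            mul_le_mul' le_rfl (pow_le_pow_of_le_one' hule (show 3 ≤ 4 by norm_num))
        _ < t * t := mul_lt_mul_left_of_ne_zero ht0 hlt
    have h2 : v (W.b₂ * x ^ 3) < t ^ 2 := by
      rw [map_mul, map_pow, hb2v, sq]; exact mul_lt_mul_left_of_ne_zero ht0 hlt
    have h3 : v (3 * W.b₄ * x ^ 2) < t ^ 2 := by
      rw [map_mul, map_mul, map_pow, hb4v, ← sq]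
      calc t ^ 2 * u ^ 2 < t ^ 2 * 1 :=
            mul_lt_mul_left_of_ne_zero (pow_ne_zero 2 ht0) (pow_lt_one₀ zero_le hult (by norm_num))
        _ = t ^ 2 := mul_one _
    have h4 : v (3 * W.b₆ * x) < t ^ 2 := by
      rw [map_mul, map_mul]
      calc t * v W.b₆ * u ≤ t * t ^ 2 * 1 := by gcongr
        _ = t ^ 2 * t := by rw [mul_one, mul_comm]
        _ < t ^ 2 * 1 := mul_lt_mul_left_of_ne_zero (pow_ne_zero 2 ht0) ht1
        _ = t ^ 2 := mul_one _
    have hr : v (3 * x ^ 4 + W.b₂ * x ^ 3 +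
        3 * W.b₄ * x ^ 2 + 3 * W.b₆ * x) <
        v W.b₈ := by
      rw [hb8v]
      exact Valuation.map_add_lt _ (Valuation.map_add_lt _ (Valuation.map_add_lt _ h1 h2) h3) h4
    refine false_of_dominant v ?_ hr
    rw [← heval]; ring
  · exact heq
  · -- `b₂ x³` dominates
    exfalso
    have hu0 : u ≠ 0 := by rintro h0; rw [h0, zero_pow (by norm_num)] at hgt; exact not_lt_zero hgt
    have htu : t < u := hgt.trans_le (by simpa using pow_le_pow_of_le_one' hule (show 1 ≤ 3 by norm_num))
    have hd : v (W.b₂ * x ^ 3) = t * u ^ 3 := by rw [map_mul, map_pow, hb2v]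
    have h1 : v (3 * x ^ 4) < t * u ^ 3 := by
      rw [map_mul, map_pow]
      have key : u ^ 3 * u < u ^ 3 * 1 := mul_lt_mul_left_of_ne_zero (pow_ne_zero 3 hu0) hult
      calc t * u ^ 4 = t * (u ^ 3 * u) := by rw [← pow_succ]
        _ < t * (u ^ 3 * 1) := mul_lt_mul_left_of_ne_zero ht0 key
        _ = t * u ^ 3 := by rw [mul_one]
    have h2 : v (3 * W.b₄ * x ^ 2) < t * u ^ 3 := by
      rw [map_mul, map_mul, map_pow, hb4v]
      have key : t * u ^ 2 < u * u ^ 2 := mul_lt_mul_right_of_ne_zero' (pow_ne_zero 2 hu0) htu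
      calc t * t * u ^ 2 = t * (t * u ^ 2) := mul_assoc _ _ _
        _ < t * (u * u ^ 2) := mul_lt_mul_left_of_ne_zero ht0 key
        _ = t * u ^ 3 := by rw [← pow_succ']
    have h3 : v (3 * W.b₆ * x) < t * u ^ 3 := by
      rw [map_mul, map_mul]
      have htu2 : t ^ 2 < u ^ 2 := pow_lt_pow_left₀ htu zero_le (by norm_num)
      have key : t ^ 2 * u < u ^ 2 * u := mul_lt_mul_right_of_ne_zero' hu0 htu2
      calc t * v W.b₆ * u ≤ t * t ^ 2 * u := by gcongr
        _ = t * (t ^ 2 * u) := mul_assoc _ _ _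
        _ < t * (u ^ 2 * u) := mul_lt_mul_left_of_ne_zero ht0 key
        _ = t * u ^ 3 := by rw [← pow_succ]
    have h4 : v W.b₈ < t * u ^ 3 := by
      rw [hb8v, sq]; exact mul_lt_mul_left_of_ne_zero ht0 hgt
    have hr : v (3 * x ^ 4 + 3 * W.b₄ * x ^ 2 +
        3 * W.b₆ * x + W.b₈) <
        v (W.b₂ * x ^ 3) := by
      rw [hd]
      exact Valuation.map_add_lt _ (Valuation.map_add_lt _ (Valuation.map_add_lt _ h1 h2) h3) h4
    refine false_of_dominant v ?_ hr
    rw [← heval]; ring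

/-- **CASE A (`v(b₂) = v(3)`): some root of `ψ₃` has `v(ξ)³ = v(3)`** on a `III`-shaped equation over
`ℚ̄` in valuation form: `ψ₃ = 3∏(X - ξᵢ)` and `v(b₈) = v(3)²`, so not every root is a unit. [folklore] -/
theorem exists_isRoot_Ψ₃_valuation_pow_three_eq' (hW3 : (3 : AlgebraicClosure ℚ) ≠ 0)
    (hb2v : (placeOver 3).valuation W.b₂ = (placeOver 3).valuation (3 : AlgebraicClosure ℚ))
    (hb4v : (placeOver 3).valuation W.b₄ = (placeOver 3).valuation (3 : AlgebraicClosure ℚ))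
    (hb6v : (placeOver 3).valuation W.b₆ ≤ (placeOver 3).valuation (3 : AlgebraicClosure ℚ) ^ 2)
    (hb8v : (placeOver 3).valuation W.b₈ = (placeOver 3).valuation (3 : AlgebraicClosure ℚ) ^ 2) :
    ∃ x : AlgebraicClosure ℚ, W.Ψ₃.IsRoot x ∧
      (placeOver 3).valuation x ^ 3 = (placeOver 3).valuation (3 : AlgebraicClosure ℚ) := by
  set v := (placeOver 3).valuation with hv
  set t := v (3 : AlgebraicClosure ℚ) with ht
  have ht1 : t < 1 := valuation_three_lt_one
  have ht0 : t ≠ 0 := valuation_three_ne_zero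
  set F := W.Ψ₃ with hF
  by_contra hcon
  simp only [not_exists, not_and] at hcon
  -- every root is then a unit
  have hunit : ∀ x, F.IsRoot x → v x = 1 := fun x hx ↦
    (valuation_eq_one_or_pow_three_eq_of_isRoot_Ψ₃' W hb2v hb4v hb6v hb8v hx).resolve_right (hcon x hx)
  -- `F = 3 ∏ (X - ξ)` over its roots
  have hsplit : F = C F.leadingCoeff * (F.roots.map (X - C ·)).prod :=
    (IsAlgClosed.splits F).eq_prod_roots
  have hdegF : F.natDegree = 4 := by rw [hF]; exact W.natDegree_Ψ₃ hW3
  have hlc : F.leadingCoeff = 3 := by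
    rw [leadingCoeff, hdegF, hF, coeff_Ψ₃]
  have hF0 : F ≠ 0 := by
    intro h0; rw [h0, natDegree_zero] at hdegF; exact absurd hdegF (by norm_num)
  -- evaluate at `0`: `b₈ = 3 ∏ (-ξ)`
  have hev0 : F.eval 0 = W.b₈ := by
    rw [hF, eval_Ψ₃]; ring
  have hev0' : F.eval 0 = 3 * (F.roots.map (fun a ↦ (0 : AlgebraicClosure ℚ) - a)).prod := by
    have := congrArg (eval (0 : AlgebraicClosure ℚ)) hsplit
    rw [eval_mul, eval_C, hlc, eval_multiset_prod, Multiset.map_map] at this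
    rw [this]
    congr 1
    refine congrArg Multiset.prod (Multiset.map_congr rfl fun a _ ↦ ?_)
    simp
  -- valuations: `v(b₈) = v(3)²` but `v(3 ∏ (-ξ)) = v(3)`
  have hprod : v ((F.roots.map (fun a ↦ (0 : AlgebraicClosure ℚ) - a)).prod) = 1 := by
    refine Multiset.prod_induction (fun z ↦ v z = 1) _ (fun a b ha hb ↦ by rw [map_mul, ha, hb, mul_one])
      (map_one v) (fun z hz ↦ ?_)
    obtain ⟨a, ha, rfl⟩ := Multiset.mem_map.mp hz
    rw [zero_sub, Valuation.map_neg]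
    exact hunit a ((mem_roots hF0).mp ha)
  have key : t ^ 2 = t := by
    rw [← hb8v, ← hev0, hev0', map_mul, hprod, mul_one]
  have : t * t = t * 1 := by rw [← sq, key, mul_one]
  exact absurd (mul_left_cancel₀ ht0 this) (ne_of_lt ht1)

end Summit.BirchSwinnertonDyer.Rank1Residual.GaloisImage

end
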